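import Mathlib
import HarnessLib

/-!
# The rung-2 strain sector of `NS₂`: the centre JET and the inviscid decay of the germ's collapse-Reynolds number
(Negative lane bookkeeping, supports `RungBlowupCofinal` / BC5 rung 2; circuit seat g9; companion of
`StrainSectorCentreLaw.lean` in this folder)

MODEL, NOT NS.  Sector equations (AGL-RUNG2-STRUCTURE §3): `aₜ = ν𝓛₇a + q`, `𝓛₇q = Q[a] − (4/3) b b′/r`,
`bₜ = ν𝓛₅b + 3ab + (3/5) r (ab)′`, with `Q[a] = −½[(216/7) a a′/r + (78/7) a a″ + (6/7) r a a‴ + (72/7) a′² + (12/7) r a′a″]`,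
`𝓛₇ = ∂² + (6/r)∂`, `𝓛₅ = ∂² + (4/r)∂`.  For even germs `a = a₀ + a₂r² + a₄r⁴ + a₆r⁶ + …`, `b = b₀ + b₂r² + …`, `q = q₀ + q₂r² + …`
every operator acts on Taylor rows; this file records the rows as `ring` identities (§1) and draws the ODE consequences (§2–§3).

§1 JET ROWS.  `Q[a] = −42a₀a₂ + (−(972/7)a₀a₄ − 66a₂²) r² + (−(2034/7)a₂a₄ − (2178/7)a₀a₆) r⁴ + …` (`source_jet`),
`𝓛₇(Σ a_{2k} r^{2k}) = Σ 2k(2k+5) a_{2k} r^{2k−2} = 14a₂ + 36a₄r² + 66a₆r⁴` (`L7_jet`), `(4/3) b b′/r = (8/3)b₀b₂ + …`,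
`3ab + (3/5)r(ab)′ = 3a₀b₀ + (21/5)(a₀b₂ + a₂b₀) r² + …`, `𝓛₅ b = 10b₂ + 28b₄r² + …`.  Matching rows of `𝓛₇q = Q[a] − (4/3)bb′/r`
(`jet_inversion`): `q₂ = −3a₀a₂ − (4/21)b₀b₂`, `q₄ = −(27/7)a₀a₄ − (11/6)a₂²` (no swirl), while `q₀` is the whole-profile integral
made local in `StrainSectorCentreLaw.centre_value_of_poisson`.  Hence the CENTRE JET LAWS of the sector:

  `ȧ₀ = −(15/14)a₀² − (2/15)b₀² + 14ν a₂`,   `ȧ₂ = −3a₀a₂ − (4/21)b₀b₂ + 36ν a₄`,   `ȧ₄ = −(27/7)a₀a₄ − (11/6)a₂² + 66ν a₆` (b ≡ 0),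
  `ḃ₀ = 3a₀b₀ + 10ν b₂`,   `ḃ₂ = (21/5)(a₀b₂ + a₂b₀) + 28ν b₄`

(`a″(0) = 2a₂`, `a⁗(0) = 24a₄`; at `ν = 0` the jet closes order by order — only `ȧ₀` needed the by-parts miracle).

§2 INVISCID CONSEQUENCE (no swirl, `ν = 0`).  For a compression germ (`a₀ < 0 < a₂`: axial compression peaked at the centre)
define the Gaussian-equivalent width `ℓ² := −2a₀/a″(0) = −a₀/a₂` and the germ's **collapse-Reynolds number**
`R := |a₀| ℓ² = a₀²/a₂` (the quantity read in every SECTOR-1c / PROBE-1 / PROBE-1b run: the turn sits at `R = 196ν/15`,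
`StrainSectorCentreLaw.centreLaw_amplifies_iff`).  Along the inviscid jet flow `ȧ₀ = −(15/14)a₀²`, `ȧ₂ = −3a₀a₂`:

  `Ṙ = (6/7) a₀ R`  (`hasDerivAt_collapseReynolds`) — strictly DECREASING on compression germs (`collapseReynolds_strictAntiOn`);
  explicitly (`inviscidJet_explicit`, `collapseReynolds_explicit`) `a₀(t) = α/(1 + (15/14)αt)`, `a₂(t) = w(1 + (15/14)αt)^{−14/5}`,
  `R(t) = (α²/w)(1 + (15/14)αt)^{4/5} → 0` as `t ↑ t* = 14/(15|α|)`: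

the inviscid rung-2 strain collapse is NEVER self-similar at the germ (`ℓ² ∝ (t*−t)^{9/5}`, not `(t*−t)`), and it EXITS every
regime `R ≥ R_c > 0` — in particular the amplifying regime `R > 196ν/15` of the viscous centre law — before the Riccati time:
«locally the germ is pushed to the dead (diffusion-dominated) stratum» (bc5w §3 / plan (v) (i-b)) as a closed-form law.
The flatness `σ := a₀a₄/a₂²` (Gaussian `½`) obeys `σ̇ = −a₀(11/6 − (15/14)σ)` (`hasDerivAt_flatness`), fixed point `77/45`.

§3 VISCOUS IDENTITY.  With `ν > 0` the 2-jet does not close (`a₄` enters): `Ṙ/R = (6/7)a₀ + 28ν a₂/a₀ − 36ν a₄/a₂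
= −(6/7)|a₀| + (36σ − 28) ν/ℓ²` (`hasDerivAt_collapseReynolds_viscous`, `collapseReynolds_rate_eq`); so `Ṙ ≥ 0` at a compression
germ needs flatness `σ ≥ 7/9 + R/(42ν)` (`flatness_of_nondecreasing`) — a Type-I lock `R ≡ R* ≥ 196ν/15` needs `σ ≥ 7/9 + 14/45 > 1`
held by the FULL profile (twice the Gaussian value).  Whether the sector PDE can hold it is OPEN (numerics SECTOR-1c, Z2-HT,
PROBE-1/1b: no lock up to A = 3000; `R ↓ 196/15` monotonically in every run).

Nothing in this file asserts a Theses declaration; numerics never move items.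
-/

namespace Summit.NavierStokesRegularity.RungBlowupCofinalStrainSectorCentreJet

open Set Filter Topology

/-! ### §1 Jet rows (pure algebra) -/

/-- **Taylor rows of the quadrupole self-straining source on a 6-jet.**  For `p(r) = a₀ + a₂r² + a₄r⁴ + a₆r⁶` (so
`p′/r = 2a₂ + 4a₄r² + 6a₆r⁴`, `p″ = 2a₂ + 12a₄r² + 30a₆r⁴`, `p‴ = 24a₄r + 120a₆r³` exactly),
`Q[p](r) = −½[(216/7) p·(p′/r) + (78/7) p p″ + (6/7) r p p‴ + (72/7) p′² + (12/7) r p′ p″]` has rows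
`Q₀ = −42a₀a₂`, `Q₂ = −(972/7)a₀a₄ − 66a₂²`, `Q₄ = −(2034/7)a₂a₄ − (2178/7)a₀a₆` (exact: no higher coefficient enters these),
and the displayed tail. -/
theorem source_jet (a0 a2 a4 a6 r : ℝ) :
    -(1 / 2 : ℝ) * ((216 / 7) * (a0 + a2 * r ^ 2 + a4 * r ^ 4 + a6 * r ^ 6) * (2 * a2 + 4 * a4 * r ^ 2 + 6 * a6 * r ^ 4)
        + (78 / 7) * (a0 + a2 * r ^ 2 + a4 * r ^ 4 + a6 * r ^ 6) * (2 * a2 + 12 * a4 * r ^ 2 + 30 * a6 * r ^ 4)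
        + (6 / 7) * r * (a0 + a2 * r ^ 2 + a4 * r ^ 4 + a6 * r ^ 6) * (24 * a4 * r + 120 * a6 * r ^ 3)
        + (72 / 7) * (2 * a2 * r + 4 * a4 * r ^ 3 + 6 * a6 * r ^ 5) ^ 2
        + (12 / 7) * r * (2 * a2 * r + 4 * a4 * r ^ 3 + 6 * a6 * r ^ 5) * (2 * a2 + 12 * a4 * r ^ 2 + 30 * a6 * r ^ 4))
      = -42 * a0 * a2 + (-(972 / 7) * a0 * a4 - 66 * a2 ^ 2) * r ^ 2
        + (-(2034 / 7) * a2 * a4 - (2178 / 7) * a0 * a6) * r ^ 4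
        + (-(1836 / 7) * a4 ^ 2 - (3768 / 7) * a2 * a6) * r ^ 6 - (6030 / 7) * a4 * a6 * r ^ 8
        - (4554 / 7) * a6 ^ 2 * r ^ 10 := by
  ring

/-- The derivative rows used in `source_jet` are the true derivatives of the 6-jet: `p′`, `p″`, `p‴`. -/
theorem jet_hasDerivAt (a0 a2 a4 a6 r : ℝ) :
    HasDerivAt (fun x => a0 + a2 * x ^ 2 + a4 * x ^ 4 + a6 * x ^ 6) (2 * a2 * r + 4 * a4 * r ^ 3 + 6 * a6 * r ^ 5) r ∧
    HasDerivAt (fun x => 2 * a2 * x + 4 * a4 * x ^ 3 + 6 * a6 * x ^ 5) (2 * a2 + 12 * a4 * r ^ 2 + 30 * a6 * r ^ 4) r ∧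
    HasDerivAt (fun x => 2 * a2 + 12 * a4 * x ^ 2 + 30 * a6 * x ^ 4) (24 * a4 * r + 120 * a6 * r ^ 3) r := by
  have hx : HasDerivAt (fun x : ℝ => x) 1 r := hasDerivAt_id' r
  refine ⟨?_, ?_, ?_⟩
  · have h := (((hx.pow 2).const_mul a2).const_add a0).fun_add (((hx.pow 4).const_mul a4)) |>.fun_add
      ((hx.pow 6).const_mul a6)
    refine (h.congr_deriv (by ring)).congr_of_eventuallyEq ?_
    exact Eventually.of_forall fun x => by simp
  · have h := (((hx.const_mul (2 * a2))).fun_add (((hx.pow 3).const_mul (4 * a4)))) |>.fun_add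
      ((hx.pow 5).const_mul (6 * a6))
    refine (h.congr_deriv (by ring)).congr_of_eventuallyEq ?_
    exact Eventually.of_forall fun x => by simp
  · have h := ((((hx.pow 2).const_mul (12 * a4))).const_add (2 * a2)).fun_add
      ((hx.pow 4).const_mul (30 * a6))
    refine (h.congr_deriv (by ring)).congr_of_eventuallyEq ?_
    exact Eventually.of_forall fun x => by simp

/-- **Taylor rows of `𝓛₇ = ∂² + (6/r)∂` on a 6-jet**: `𝓛₇ r^{2k} = 2k(2k+5) r^{2k−2}`, i.e.
`p″ + 6 (p′/r) = 14a₂ + 36a₄ r² + 66a₆ r⁴`. -/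
theorem L7_jet (a2 a4 a6 r : ℝ) :
    (2 * a2 + 12 * a4 * r ^ 2 + 30 * a6 * r ^ 4) + 6 * (2 * a2 + 4 * a4 * r ^ 2 + 6 * a6 * r ^ 4)
      = 14 * a2 + 36 * a4 * r ^ 2 + 66 * a6 * r ^ 4 := by
  ring

/-- **Taylor rows of `𝓛₅ = ∂² + (4/r)∂` on a 4-jet** (swirl diffusion): `𝓛₅ r^{2k} = 2k(2k+3) r^{2k−2}`, i.e.
`b″ + 4(b′/r) = 10b₂ + 28b₄ r²` for `b = b₀ + b₂r² + b₄r⁴`. -/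
theorem L5_jet (b2 b4 r : ℝ) :
    (2 * b2 + 12 * b4 * r ^ 2) + 4 * (2 * b2 + 4 * b4 * r ^ 2) = 10 * b2 + 28 * b4 * r ^ 2 := by
  ring

/-- **Swirl rows.** For `b = b₀ + b₂r² + b₄r⁴` and `p = a₀ + a₂r² + a₄r⁴`: the Poisson source `(4/3) b (b′/r)` has constant row
`(8/3) b₀b₂`, and the vortex-stretching channel `3pb + (3/5) r (pb)′` has rows `3a₀b₀` and `(21/5)(a₀b₂ + a₂b₀)`. -/
theorem swirl_jet (a0 a2 a4 b0 b2 b4 r : ℝ) :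
    (4 / 3 : ℝ) * (b0 + b2 * r ^ 2 + b4 * r ^ 4) * (2 * b2 + 4 * b4 * r ^ 2)
        = (8 / 3) * b0 * b2 + ((8 / 3) * b2 ^ 2 + (16 / 3) * b0 * b4) * r ^ 2 + 8 * b2 * b4 * r ^ 4
          + (16 / 3) * b4 ^ 2 * r ^ 6 ∧
      3 * (a0 + a2 * r ^ 2 + a4 * r ^ 4) * (b0 + b2 * r ^ 2 + b4 * r ^ 4)
        + (3 / 5) * r * ((2 * a2 * r + 4 * a4 * r ^ 3) * (b0 + b2 * r ^ 2 + b4 * r ^ 4)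
            + (a0 + a2 * r ^ 2 + a4 * r ^ 4) * (2 * b2 * r + 4 * b4 * r ^ 3))
        = 3 * a0 * b0 + (21 / 5) * (a0 * b2 + a2 * b0) * r ^ 2 + (27 / 5) * (a4 * b0 + a2 * b2 + a0 * b4) * r ^ 4
          + (33 / 5) * (a4 * b2 + a2 * b4) * r ^ 6 + (39 / 5) * a4 * b4 * r ^ 8 := by
  constructor <;> ring

/-- **Jet inversion of the sector Poisson equation.**  Matching the `r⁰` and `r²` rows of `𝓛₇q = Q[a] − (4/3) b b′/r`
(`14q₂ = Q₀ − (8/3)b₀b₂`, `36q₄ = Q₂` with no swirl) gives `q₂ = −3a₀a₂ − (4/21)b₀b₂` and `q₄ = −(27/7)a₀a₄ − (11/6)a₂²`;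
with `ȧ_{2k} = q_{2k} + ν(𝓛₇a)_{2k}` these are the centre jet laws `ȧ₂ = −3a₀a₂ − (4/21)b₀b₂ + 36νa₄`,
`ȧ₄ = −(27/7)a₀a₄ − (11/6)a₂² + 66νa₆` quoted in the module docstring. -/
theorem jet_inversion (a0 a2 a4 b0 b2 q2 q4 : ℝ) :
    (14 * q2 = -42 * a0 * a2 - (8 / 3) * b0 * b2 ↔ q2 = -3 * a0 * a2 - (4 / 21) * b0 * b2) ∧
    (36 * q4 = -(972 / 7) * a0 * a4 - 66 * a2 ^ 2 ↔ q4 = -(27 / 7) * a0 * a4 - (11 / 6) * a2 ^ 2) := by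
  constructor
  · constructor <;> intro h <;> linarith
  · constructor <;> intro h <;> linarith

/-! ### §2 The inviscid centre jet: decay of the collapse-Reynolds number -/

/-- **`Ṙ = (6/7) a₀ R` along the inviscid centre jet.**  If `ȧ₀ = −(15/14)a₀²` and `ȧ₂ = −3a₀a₂` at `t` and `a₂(t) ≠ 0`,
then the collapse-Reynolds number `R = a₀²/a₂` has derivative `(6/7) a₀(t) R(t)` at `t`. -/
theorem hasDerivAt_collapseReynolds {a0 a2 : ℝ → ℝ} {t : ℝ}
    (h0 : HasDerivAt a0 (-(15 / 14) * a0 t ^ 2) t) (h2 : HasDerivAt a2 (-3 * a0 t * a2 t) t) (ha2 : a2 t ≠ 0) :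
    HasDerivAt (fun s => a0 s ^ 2 / a2 s) ((6 / 7) * a0 t * (a0 t ^ 2 / a2 t)) t := by
  have h := (h0.pow 2).div h2 ha2
  refine h.congr_deriv ?_
  simp only [Pi.pow_apply]
  norm_num
  field_simp
  ring

/-- **Flatness law.**  Along the inviscid 3-jet `ȧ₀ = −(15/14)a₀²`, `ȧ₂ = −3a₀a₂`, `ȧ₄ = −(27/7)a₀a₄ − (11/6)a₂²` the flatness
`σ = a₀a₄/a₂²` obeys `σ̇ = −a₀ (11/6 − (15/14) σ)` (for a compression germ `a₀ < 0`: `σ` relaxes to `77/45`). -/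
theorem hasDerivAt_flatness {a0 a2 a4 : ℝ → ℝ} {t : ℝ}
    (h0 : HasDerivAt a0 (-(15 / 14) * a0 t ^ 2) t) (h2 : HasDerivAt a2 (-3 * a0 t * a2 t) t)
    (h4 : HasDerivAt a4 (-(27 / 7) * a0 t * a4 t - (11 / 6) * a2 t ^ 2) t) (ha2 : a2 t ≠ 0) :
    HasDerivAt (fun s => a0 s * a4 s / a2 s ^ 2)
      (-a0 t * (11 / 6 - (15 / 14) * (a0 t * a4 t / a2 t ^ 2))) t := by
  have h := (h0.mul h4).div (h2.pow 2) (pow_ne_zero 2 ha2)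
  refine h.congr_deriv ?_
  simp only [Pi.pow_apply, Pi.mul_apply]
  norm_num
  field_simp
  ring

/-- **Monotone decay of the collapse-Reynolds number on compression germs.**  If on an open time interval the inviscid
centre jet holds with `a₀ < 0 < a₂` (axial compression peaked at the centre), then `R = a₀²/a₂ = |a₀|ℓ²` is STRICTLY
DECREASING there: the profile sharpens faster than self-similarly. -/
theorem collapseReynolds_strictAntiOn {a0 a2 : ℝ → ℝ} {T₁ T₂ : ℝ}
    (h0 : ∀ t ∈ Ioo T₁ T₂, HasDerivAt a0 (-(15 / 14) * a0 t ^ 2) t)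
    (h2 : ∀ t ∈ Ioo T₁ T₂, HasDerivAt a2 (-3 * a0 t * a2 t) t)
    (hneg : ∀ t ∈ Ioo T₁ T₂, a0 t < 0) (hpos : ∀ t ∈ Ioo T₁ T₂, 0 < a2 t) :
    StrictAntiOn (fun s => a0 s ^ 2 / a2 s) (Ioo T₁ T₂) := by
  have hD : ∀ t ∈ Ioo T₁ T₂, HasDerivAt (fun s => a0 s ^ 2 / a2 s) ((6 / 7) * a0 t * (a0 t ^ 2 / a2 t)) t :=
    fun t ht => hasDerivAt_collapseReynolds (h0 t ht) (h2 t ht) (hpos t ht).ne'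
  refine strictAntiOn_of_hasDerivWithinAt_neg (convex_Ioo T₁ T₂)
    (f' := fun t => (6 / 7) * a0 t * (a0 t ^ 2 / a2 t))
    (fun t ht => (hD t ht).continuousAt.continuousWithinAt) ?_ ?_
  · intro t ht
    rw [interior_Ioo] at ht ⊢
    exact (hD t ht).hasDerivWithinAt
  · intro t ht
    rw [interior_Ioo] at ht
    have hR : 0 < a0 t ^ 2 / a2 t := div_pos (by nlinarith [hneg t ht]) (hpos t ht)
    have : (6 / 7 : ℝ) * a0 t < 0 := by nlinarith [hneg t ht]
    exact mul_neg_of_neg_of_pos this hR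

/-- **The explicit inviscid jet flow.**  For data `α` (`= a₀(0)`) and `w` (`= a₂(0)`), on the time set where
`0 < 1 + (15/14)αt` the functions `a₀(t) = α/(1 + (15/14)αt)` and `a₂(t) = w·(1 + (15/14)αt)^{−14/5}` solve
`ȧ₀ = −(15/14)a₀²`, `ȧ₂ = −3a₀a₂` (Riccati amplitude; curvature growing like the `14/5` power of the amplitude). -/
theorem inviscidJet_explicit (α w t : ℝ) (ht : 0 < 1 + (15 / 14) * α * t) :
    HasDerivAt (fun s => α / (1 + (15 / 14) * α * s))
        (-(15 / 14) * (α / (1 + (15 / 14) * α * t)) ^ 2) t ∧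
      HasDerivAt (fun s => w * (1 + (15 / 14) * α * s) ^ (-(14 / 5) : ℝ))
        (-3 * (α / (1 + (15 / 14) * α * t)) * (w * (1 + (15 / 14) * α * t) ^ (-(14 / 5) : ℝ))) t := by
  have hlin : HasDerivAt (fun s : ℝ => 1 + (15 / 14) * α * s) ((15 / 14) * α) t := by
    have h := ((hasDerivAt_id' t).const_mul ((15 / 14) * α)).const_add 1
    exact h.congr_deriv (by ring)
  have hne : (1 + (15 / 14) * α * t) ≠ 0 := ht.ne'
  constructor
  · have h := (hasDerivAt_const t α).div hlin hne
    refine h.congr_deriv ?_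
    field_simp
    ring
  · have h := (hlin.rpow_const (p := (-(14 / 5) : ℝ)) (Or.inl hne)).const_mul w
    refine h.congr_deriv ?_
    have hsplit : (1 + (15 / 14) * α * t) ^ (-(14 / 5) - 1 : ℝ)
        = (1 + (15 / 14) * α * t) ^ (-(14 / 5) : ℝ) / (1 + (15 / 14) * α * t) := by
      rw [Real.rpow_sub_one hne]
    rw [hsplit]
    field_simp
    ring

/-- **Closed form of the collapse-Reynolds number along the explicit flow**: `R(t) = (α²/w)·(1 + (15/14)αt)^{4/5}`.  For a
compression germ (`α < 0`) the bracket decreases from `1` to `0` as `t ↑ t* = 14/(15|α|)`: `R → 0` like `(t* − t)^{4/5}` while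
`|a₀| → ∞` like `(t* − t)^{−1}` — the inviscid strain collapse leaves every regime `R ≥ R_c > 0` before its Riccati time. -/
theorem collapseReynolds_explicit (α w t : ℝ) (ht : 0 < 1 + (15 / 14) * α * t) :
    (α / (1 + (15 / 14) * α * t)) ^ 2 / (w * (1 + (15 / 14) * α * t) ^ (-(14 / 5) : ℝ))
      = α ^ 2 / w * (1 + (15 / 14) * α * t) ^ ((4 / 5) : ℝ) := by
  set x := 1 + (15 / 14) * α * t with hx
  have hprod : x ^ 2 * x ^ (-(14 / 5) : ℝ) * x ^ ((4 / 5) : ℝ) = 1 := by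
    rw [← Real.rpow_two, ← Real.rpow_add ht, ← Real.rpow_add ht]
    norm_num
  have hx2 : x ^ 2 ≠ 0 := pow_ne_zero 2 ht.ne'
  have hx14 : x ^ (-(14 / 5) : ℝ) ≠ 0 := (Real.rpow_pos_of_pos ht _).ne'
  have h45 : x ^ ((4 / 5) : ℝ) = 1 / (x ^ 2 * x ^ (-(14 / 5) : ℝ)) := by
    rw [eq_div_iff (mul_ne_zero hx2 hx14)]
    linarith [hprod]
  by_cases hw : w = 0
  · simp [hw]
  rw [h45, div_pow]
  field_simp

/-- **Quantitative exit (explicit flow).**  With `α < 0 < w` put `R₀ = α²/w` and `t* = 14/(15|α|) = −14/(15α)`.  For every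
threshold `R_c ∈ (0, R₀]` the explicit collapse-Reynolds number is `≤ R_c` at the time `t_c = t*·(1 − (R_c/R₀)^{5/4}) < t*`
(indeed it EQUALS `R_c` there). In particular the inviscid germ spends the whole final stretch `[t_c, t*)` below `R_c`. -/
theorem collapseReynolds_exit {α w Rc : ℝ} (hα : α < 0) (hw : 0 < w) (hRc : 0 < Rc) (hle : Rc ≤ α ^ 2 / w) :
    let tstar := -14 / (15 * α)
    let tc := tstar * (1 - (Rc / (α ^ 2 / w)) ^ ((5 / 4) : ℝ))
    0 ≤ tc ∧ tc < tstar ∧ 0 < 1 + (15 / 14) * α * tc ∧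
      α ^ 2 / w * (1 + (15 / 14) * α * tc) ^ ((4 / 5) : ℝ) = Rc := by
  intro tstar tc
  have hR0 : 0 < α ^ 2 / w := div_pos (by nlinarith) hw
  have hq : 0 < Rc / (α ^ 2 / w) := div_pos hRc hR0
  have hq1 : Rc / (α ^ 2 / w) ≤ 1 := (div_le_one hR0).2 hle
  have hθ : 0 < (Rc / (α ^ 2 / w)) ^ ((5 / 4) : ℝ) := Real.rpow_pos_of_pos hq _
  have hθ1 : (Rc / (α ^ 2 / w)) ^ ((5 / 4) : ℝ) ≤ 1 := Real.rpow_le_one hq.le hq1 (by norm_num)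
  have hts : 0 < tstar := by
    show 0 < -14 / (15 * α)
    apply div_pos_of_neg_of_neg <;> linarith
  have hα0 : α ≠ 0 := hα.ne
  have hw0 : w ≠ 0 := hw.ne'
  have hkey : (15 / 14 : ℝ) * α * tstar = -1 := by
    show (15 / 14 : ℝ) * α * (-14 / (15 * α)) = -1
    field_simp
  have hbracket : 1 + (15 / 14) * α * tc = (Rc / (α ^ 2 / w)) ^ ((5 / 4) : ℝ) := by
    show 1 + (15 / 14) * α * (tstar * (1 - (Rc / (α ^ 2 / w)) ^ ((5 / 4) : ℝ))) = _
    calc 1 + (15 / 14) * α * (tstar * (1 - (Rc / (α ^ 2 / w)) ^ ((5 / 4) : ℝ)))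
        = 1 + ((15 / 14) * α * tstar) * (1 - (Rc / (α ^ 2 / w)) ^ ((5 / 4) : ℝ)) := by ring
      _ = (Rc / (α ^ 2 / w)) ^ ((5 / 4) : ℝ) := by rw [hkey]; ring
  refine ⟨?_, ?_, ?_, ?_⟩
  · exact mul_nonneg hts.le (by linarith)
  · have : tstar * (1 - (Rc / (α ^ 2 / w)) ^ ((5 / 4) : ℝ)) < tstar * 1 :=
      mul_lt_mul_of_pos_left (by linarith) hts
    simpa using this
  · rw [hbracket]; exact hθ
  · rw [hbracket, ← Real.rpow_mul hq.le]
    norm_num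
    field_simp

/-! ### §3 The viscous 2-jet identity -/

/-- **`Ṙ` with viscosity.**  If `ȧ₀ = −(15/14)a₀² + 14ν a₂` and `ȧ₂ = −3a₀a₂ + 36ν a₄` (the `r⁰`/`r²` rows of
`aₜ = ν𝓛₇a + q` without swirl) with `a₀(t), a₂(t) ≠ 0`, then
`Ṙ = R · ((6/7)a₀ + 28ν a₂/a₀ − 36ν a₄/a₂)`. -/
theorem hasDerivAt_collapseReynolds_viscous {ν : ℝ} {a0 a2 a4 : ℝ → ℝ} {t : ℝ}
    (h0 : HasDerivAt a0 (-(15 / 14) * a0 t ^ 2 + 14 * ν * a2 t) t)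
    (h2 : HasDerivAt a2 (-3 * a0 t * a2 t + 36 * ν * a4 t) t) (ha0 : a0 t ≠ 0) (ha2 : a2 t ≠ 0) :
    HasDerivAt (fun s => a0 s ^ 2 / a2 s)
      ((a0 t ^ 2 / a2 t) * ((6 / 7) * a0 t + 28 * ν * a2 t / a0 t - 36 * ν * a4 t / a2 t)) t := by
  have h := (h0.pow 2).div h2 ha2
  refine h.congr_deriv ?_
  simp only [Pi.pow_apply]
  norm_num
  field_simp
  ring

/-- **The same rate in germ variables.**  With `ℓ² = −a₀/a₂` (curvature width²), `R = a₀²/a₂` and flatness `σ = a₀a₄/a₂²`: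
`(6/7)a₀ + 28ν a₂/a₀ − 36ν a₄/a₂ = (6/7)a₀ + (36σ − 28)ν/ℓ²`, and `ν/ℓ² = −ν a₀/R`. -/
theorem collapseReynolds_rate_eq {ν a0 a2 a4 : ℝ} (ha0 : a0 ≠ 0) (ha2 : a2 ≠ 0) :
    (6 / 7) * a0 + 28 * ν * a2 / a0 - 36 * ν * a4 / a2
        = (6 / 7) * a0 + (36 * (a0 * a4 / a2 ^ 2) - 28) * ν / (-a0 / a2) ∧
      ν / (-a0 / a2) = -ν * a0 / (a0 ^ 2 / a2) := by
  constructor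
  · field_simp
    ring
  · field_simp

/-- **Flatness needed to stop the decay.**  At a compression germ (`a₀ < 0 < a₂`, so `ℓ² = −a₀/a₂ > 0`, `R = a₀²/a₂ > 0`) with
`ν > 0`: the logarithmic rate `(6/7)a₀ + (36σ − 28)ν/ℓ²` is `≥ 0` iff `σ ≥ 7/9 + R/(42ν)`.  So a non-decreasing
collapse-Reynolds number — a fortiori a Type-I lock `R ≡ R* ≥ 196ν/15`, which needs `σ ≥ 7/9 + 14/45 > 1` — requires the
profile to be at least twice as flat at the centre as a Gaussian (`σ = ½`), sustained by the full (non-jet) dynamics. -/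
theorem flatness_of_nondecreasing {ν a0 a2 σ : ℝ} (hν : 0 < ν) (ha0 : a0 < 0) (ha2 : 0 < a2) :
    0 ≤ (6 / 7) * a0 + (36 * σ - 28) * ν / (-a0 / a2) ↔ 7 / 9 + (a0 ^ 2 / a2) / (42 * ν) ≤ σ := by
  have hl : 0 < -a0 / a2 := div_pos (by linarith) ha2
  have key : (6 / 7) * a0 + (36 * σ - 28) * ν / (-a0 / a2)
      = (36 * ν / (-a0 / a2)) * (σ - (7 / 9 + (a0 ^ 2 / a2) / (42 * ν))) := by
    field_simp
    ring
  rw [key]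
  have hc : 0 < 36 * ν / (-a0 / a2) := div_pos (by linarith) hl
  constructor
  · intro h
    by_contra hlt
    have hlt : σ < 7 / 9 + a0 ^ 2 / a2 / (42 * ν) := lt_of_not_ge hlt
    have : 36 * ν / (-a0 / a2) * (σ - (7 / 9 + a0 ^ 2 / a2 / (42 * ν))) < 0 :=
      mul_neg_of_pos_of_neg hc (by linarith)
    linarith
  · intro h
    exact mul_nonneg hc.le (by linarith)

end Summit.NavierStokesRegularity.RungBlowupCofinalStrainSectorCentreJet
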